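import Mathlib
import Literature.Analysis.FluidPDE.VectorCalculus

/-!
# Pointwise Taylor brick of the local-induction asymptotics of a vortex filament

Tools stub `stub_liaCrossExpansion` of line `Sketch` (crux `SkeletonEquilibrium`, thesis
`FilamentSkeletonRss`). At a point of a unit-speed `C^{2,1}` curve with unit tangent `T`,
curvature vector `N` (`‖N‖ ≤ κ₀`, `T ⊥ N`), write the tangent at parameter distance `s` as
`a = T + s N + r₁` with `‖r₁‖ ≤ H s²` and the chord as `z = s T + (s²/2) N + r₂` with
`‖r₂‖ ≤ H |s|³`. Then

* the Biot–Savart numerator satisfies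
  `‖a × (−z) − (s²/2) T × N‖ ≤ 2 H |s|³ + (3/2) κ₀ H s⁴ + H² |s|⁵`;
* the squared chord length satisfies
  `|‖z‖² − s²| ≤ κ₀² s⁴ / 4 + 2 H s⁴ + κ₀ H |s|⁵ + H² s⁶`.

Proof. (1) Expanding bilinearly with `T × T = N × N = 0`, `N × T = −T × N`,
`a × (−z) − (s²/2) T × N = −(T × r₂ + s (N × r₂) + s (r₁ × T) + (s²/2) (r₁ × N) + r₁ × r₂)`
(checked in coordinates), and each term is bounded by `‖u × v‖ ≤ ‖u‖ ‖v‖`.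
(2) With `w = s T + (s²/2) N`, Pythagoras gives `‖w‖² = s² + (s²/2)² ‖N‖²`, so
`‖z‖² − s² = (s²/2)² ‖N‖² + 2 ⟪w, r₂⟫ + ‖r₂‖²` with `|⟪w, r₂⟫| ≤ (|s| + (s²/2) κ₀) H |s|³`
(Cauchy–Schwarz).
-/

noncomputable section

open MeasureTheory Filter Topology
open Literature.Analysis.FluidPDE

namespace Summit.NavierStokesRegularity.NavierStokesRegularity.Theorems.SkeletonEquilibrium.Sketch
set_option linter.dupNamespace false

/-- `‖v × w‖ ≤ ‖v‖ ‖w‖` (from `norm_cross`, `sin ≤ 1`). [folklore] -/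
private theorem lce_norm_cross_le (v w : EuclideanSpace ℝ (Fin 3)) :
    ‖cross v w‖ ≤ ‖v‖ * ‖w‖ := by
  rw [norm_cross]
  exact mul_le_of_le_one_right (by positivity) (Real.sin_le_one _)

/-- The bilinear expansion of `a × (−z) − (s²/2) T × N` for `a = T + s N + r₁`,
`z = s T + (s²/2) N + r₂` (`T × T = N × N = 0`, `N × T = −T × N`), checked in coordinates.
[folklore] -/
private theorem lce_cross_expansion (s : ℝ) (T N r₁ r₂ : EuclideanSpace ℝ (Fin 3)) :
    cross (T + s • N + r₁) (-(s • T + (s ^ 2 / 2) • N + r₂)) - (s ^ 2 / 2) • cross T N =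
      -(cross T r₂ + s • cross N r₂ + s • cross r₁ T + (s ^ 2 / 2) • cross r₁ N + cross r₁ r₂) := by
  ext i
  fin_cases i <;>
    simp [cross, cross_apply, Matrix.cons_val_zero, Matrix.cons_val_one, Matrix.cons_val_two,
      Matrix.head_cons, Matrix.tail_cons] <;> ring

/-- Part (1): the cubic remainder bound for the Biot–Savart numerator,
`‖a × (−z) − (s²/2) T × N‖ ≤ 2 H |s|³ + (3/2) κ₀ H s⁴ + H² |s|⁵`. [folklore] -/
private theorem lce_cross_remainder_bound {s H κ₀ : ℝ} {T N r₁ r₂ : EuclideanSpace ℝ (Fin 3)}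
    (hH : 0 ≤ H) (hκ : 0 ≤ κ₀) (hT : ‖T‖ = 1) (hN : ‖N‖ ≤ κ₀)
    (hr₁ : ‖r₁‖ ≤ H * s ^ 2) (hr₂ : ‖r₂‖ ≤ H * |s| ^ 3) :
    ‖cross (T + s • N + r₁) (-(s • T + (s ^ 2 / 2) • N + r₂)) - (s ^ 2 / 2) • cross T N‖ ≤
      2 * H * |s| ^ 3 + 3 / 2 * κ₀ * H * s ^ 4 + H ^ 2 * |s| ^ 5 := by
  rw [lce_cross_expansion, norm_neg]
  have ht : 0 ≤ |s| := abs_nonneg s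
  have hs2 : s ^ 2 = |s| ^ 2 := (sq_abs s).symm
  have hs4 : s ^ 4 = |s| ^ 4 := (Even.pow_abs (by decide) s).symm
  have h1 : ‖cross T r₂‖ ≤ H * |s| ^ 3 := by
    calc ‖cross T r₂‖ ≤ ‖T‖ * ‖r₂‖ := lce_norm_cross_le _ _
      _ ≤ 1 * (H * |s| ^ 3) := by rw [hT]; exact mul_le_mul_of_nonneg_left hr₂ zero_le_one
      _ = H * |s| ^ 3 := one_mul _
  have h2 : ‖s • cross N r₂‖ ≤ |s| * (κ₀ * (H * |s| ^ 3)) := by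
    rw [norm_smul, Real.norm_eq_abs]
    exact mul_le_mul_of_nonneg_left
      ((lce_norm_cross_le _ _).trans (mul_le_mul hN hr₂ (norm_nonneg _) hκ)) ht
  have h3 : ‖s • cross r₁ T‖ ≤ |s| * (H * s ^ 2) := by
    rw [norm_smul, Real.norm_eq_abs]
    refine mul_le_mul_of_nonneg_left ?_ ht
    calc ‖cross r₁ T‖ ≤ ‖r₁‖ * ‖T‖ := lce_norm_cross_le _ _
      _ = ‖r₁‖ := by rw [hT, mul_one]
      _ ≤ H * s ^ 2 := hr₁
  have h4 : ‖(s ^ 2 / 2) • cross r₁ N‖ ≤ s ^ 2 / 2 * (H * s ^ 2 * κ₀) := by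
    rw [norm_smul, Real.norm_eq_abs, abs_of_nonneg (by positivity : (0 : ℝ) ≤ s ^ 2 / 2)]
    exact mul_le_mul_of_nonneg_left
      ((lce_norm_cross_le _ _).trans (mul_le_mul hr₁ hN (norm_nonneg _) (by positivity)))
      (by positivity)
  have h5 : ‖cross r₁ r₂‖ ≤ H * s ^ 2 * (H * |s| ^ 3) :=
    (lce_norm_cross_le _ _).trans (mul_le_mul hr₁ hr₂ (norm_nonneg _) (by positivity))
  calc ‖cross T r₂ + s • cross N r₂ + s • cross r₁ T + (s ^ 2 / 2) • cross r₁ N + cross r₁ r₂‖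
      ≤ H * |s| ^ 3 + |s| * (κ₀ * (H * |s| ^ 3)) + |s| * (H * s ^ 2) + s ^ 2 / 2 * (H * s ^ 2 * κ₀) +
          H * s ^ 2 * (H * |s| ^ 3) :=
        norm_add_le_of_le (norm_add_le_of_le (norm_add_le_of_le (norm_add_le_of_le h1 h2) h3) h4) h5
    _ = 2 * H * |s| ^ 3 + 3 / 2 * κ₀ * H * s ^ 4 + H ^ 2 * |s| ^ 5 := by
        rw [hs2, hs4]; ring

/-- Part (2): the quartic remainder bound for the squared chord length,
`|‖z‖² − s²| ≤ κ₀² s⁴ / 4 + 2 H s⁴ + κ₀ H |s|⁵ + H² s⁶`. [folklore] -/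
private theorem lce_chord_sq_bound {s H κ₀ : ℝ} {T N r₂ : EuclideanSpace ℝ (Fin 3)}
    (hκ : 0 ≤ κ₀) (hT : ‖T‖ = 1) (hN : ‖N‖ ≤ κ₀) (hTN : inner ℝ T N = 0)
    (hr₂ : ‖r₂‖ ≤ H * |s| ^ 3) :
    |‖s • T + (s ^ 2 / 2) • N + r₂‖ ^ 2 - s ^ 2| ≤
      κ₀ ^ 2 * s ^ 4 / 4 + 2 * H * s ^ 4 + κ₀ * H * |s| ^ 5 + H ^ 2 * s ^ 6 := by
  have ht : 0 ≤ |s| := abs_nonneg s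
  have hs2 : s ^ 2 = |s| ^ 2 := (sq_abs s).symm
  have hs4 : s ^ 4 = |s| ^ 4 := (Even.pow_abs (by decide) s).symm
  have hs6 : s ^ 6 = |s| ^ 6 := (Even.pow_abs (by decide) s).symm
  -- Pythagoras for the main part `w = s T + (s²/2) N`.
  have hw : ‖s • T + (s ^ 2 / 2) • N‖ ^ 2 = s ^ 2 + (s ^ 2 / 2) ^ 2 * ‖N‖ ^ 2 := by
    rw [norm_add_sq_real, real_inner_smul_left, real_inner_smul_right, hTN, norm_smul, norm_smul,
      hT, Real.norm_eq_abs, Real.norm_eq_abs, mul_pow, mul_pow, sq_abs, sq_abs]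
    ring
  have hexp : ‖s • T + (s ^ 2 / 2) • N + r₂‖ ^ 2 - s ^ 2 =
      (s ^ 2 / 2) ^ 2 * ‖N‖ ^ 2 + 2 * inner ℝ (s • T + (s ^ 2 / 2) • N) r₂ + ‖r₂‖ ^ 2 := by
    rw [norm_add_sq_real, hw]; ring
  have hwn : ‖s • T + (s ^ 2 / 2) • N‖ ≤ |s| + s ^ 2 / 2 * κ₀ := by
    refine norm_add_le_of_le ?_ ?_
    · rw [norm_smul, Real.norm_eq_abs, hT, mul_one]
    · rw [norm_smul, Real.norm_eq_abs, abs_of_nonneg (by positivity : (0 : ℝ) ≤ s ^ 2 / 2)]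
      exact mul_le_mul_of_nonneg_left hN (by positivity)
  have hinner := abs_le.mp (abs_real_inner_le_norm (s • T + (s ^ 2 / 2) • N) r₂)
  have hprod : ‖s • T + (s ^ 2 / 2) • N‖ * ‖r₂‖ ≤ H * s ^ 4 + κ₀ * H * |s| ^ 5 / 2 :=
    (mul_le_mul hwn hr₂ (norm_nonneg _) (by positivity)).trans_eq (by rw [hs2, hs4]; ring)
  have hNs : (s ^ 2 / 2) ^ 2 * ‖N‖ ^ 2 ≤ κ₀ ^ 2 * s ^ 4 / 4 := by
    have hN2 : ‖N‖ ^ 2 ≤ κ₀ ^ 2 := by gcongr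
    exact (mul_le_mul_of_nonneg_left hN2 (by positivity)).trans_eq (by ring)
  have hr₂sq : ‖r₂‖ ^ 2 ≤ H ^ 2 * s ^ 6 := by
    have h : ‖r₂‖ ^ 2 ≤ (H * |s| ^ 3) ^ 2 := by gcongr
    exact h.trans_eq (by rw [hs6]; ring)
  have hA : 0 ≤ (s ^ 2 / 2) ^ 2 * ‖N‖ ^ 2 := by positivity
  have hC : 0 ≤ ‖r₂‖ ^ 2 := by positivity
  have hK : 0 ≤ κ₀ ^ 2 * s ^ 4 / 4 := by positivity
  have hS : 0 ≤ H ^ 2 * s ^ 6 := by positivity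
  rw [hexp, abs_le]
  exact ⟨by linarith [hinner.1], by linarith [hinner.2]⟩

/-- **Pointwise Taylor brick of the local-induction asymptotics.** For a unit vector `T`, a vector
`N` with `‖N‖ ≤ κ₀` and `⟪T, N⟫ = 0`, a "tangent" `a` with `‖a − T − s N‖ ≤ H s²` and a "chord"
`z` with `‖z − s T − (s²/2) N‖ ≤ H |s|³`:
`‖a × (−z) − (s²/2) T × N‖ ≤ 2 H |s|³ + (3/2) κ₀ H s⁴ + H² |s|⁵` and
`|‖z‖² − s²| ≤ κ₀² s⁴ / 4 + 2 H s⁴ + κ₀ H |s|⁵ + H² s⁶`. [folklore] -/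
theorem stub_liaCrossExpansion :
    ∀ (s H κ₀ : ℝ) (T N a z : EuclideanSpace ℝ (Fin 3)),
      0 ≤ H → 0 ≤ κ₀ → ‖T‖ = 1 → ‖N‖ ≤ κ₀ → inner ℝ T N = 0 →
      ‖a - T - s • N‖ ≤ H * s ^ 2 → ‖z - s • T - (s ^ 2 / 2) • N‖ ≤ H * |s| ^ 3 →
      ‖cross a (-z) - (s ^ 2 / 2) • cross T N‖ ≤ 2 * H * |s| ^ 3 + 3 / 2 * κ₀ * H * s ^ 4 + H ^ 2 * |s| ^ 5 ∧
      |‖z‖ ^ 2 - s ^ 2| ≤ κ₀ ^ 2 * s ^ 4 / 4 + 2 * H * s ^ 4 + κ₀ * H * |s| ^ 5 + H ^ 2 * s ^ 6 := by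
  intro s H κ₀ T N a z hH hκ hT hN hTN hr₁ hr₂
  obtain ⟨r₁, rfl⟩ : ∃ r₁, a = T + s • N + r₁ := ⟨a - T - s • N, by abel⟩
  obtain ⟨r₂, rfl⟩ : ∃ r₂, z = s • T + (s ^ 2 / 2) • N + r₂ :=
    ⟨z - s • T - (s ^ 2 / 2) • N, by abel⟩
  rw [show T + s • N + r₁ - T - s • N = r₁ by abel] at hr₁
  rw [show s • T + (s ^ 2 / 2) • N + r₂ - s • T - (s ^ 2 / 2) • N = r₂ by abel] at hr₂
  exact ⟨lce_cross_remainder_bound hH hκ hT hN hr₁ hr₂, lce_chord_sq_bound hκ hT hN hTN hr₂⟩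

end Summit.NavierStokesRegularity.NavierStokesRegularity.Theorems.SkeletonEquilibrium.Sketch

end
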